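import Literature.RingTheory.MvPowerSeries.MaximalIdealPow
import Literature.AlgebraicGeometry.Resolution.PowerSeriesRegularLocal
import HarnessLib

/-!
# The chart endomorphism `x ↦ x, y ↦ x (y + t)` of `κ⟦x, y⟧`: leading slice, injectivity

`Literature/AlgebraicGeometry/Resolution/PlaneChartEndomorphism.lean`. Let `κ` be a field,
`R = κ⟦X₀, X₁⟧ = MvPowerSeries (Fin 2) κ`, `i ≠ j` the two indices and `t ∈ κ`. A `κ`-algebra
endomorphism `Θ` of `R` with `Θ (X i) = X i` and `Θ (X j) = X i * (X j + C t)` is the ring-level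
form of "blow up the closed point, pass to the chart `X i ≠ 0`, and move the point `X j / X i = t`
of the exceptional line to the origin" (the quadratic transformation followed by a translation,
Zariski–Samuel II App. 5; Huneke–Swanson §14.1; Casas-Alvero §3.2). PROVED here:

* `map_maximalIdeal_le_span_X` — `Θ(𝔪) ⊆ (X i)`, hence `Θ(𝔪ᴺ) ⊆ (X i ^ N)`
  (`X_pow_dvd_of_mem_maximalIdeal_pow`) and `Θ g ≡ g(0) (mod X i)` (`X_dvd_sub_C_constantCoeff`);
* `coeff_leading_slice` — the LEADING SLICE FORMULA: for `g ∈ 𝔪ᵈ`, the coefficient of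
  `X i ^ d * X j ^ k` in `Θ g` is the `k`-th coefficient of the Taylor expansion at `t` of the
  dehomogenised degree-`d` form `P(y) = Σ_l g_{(d-l) eᵢ + l eⱼ} yˡ` of `g`;
* `injective_of_chart` — such a `Θ` is injective.

Everything is PROVED; no definitions. These are the elementary facts behind the colength count of
`PlaneChartColength.lean`.

## References
* [HunekeSwanson2006] C. Huneke, I. Swanson, Integral Closure of Ideals, Rings, and Modules, CUP 2006, §14.1.
* [ZariskiSamuel1960] O. Zariski, P. Samuel, Commutative Algebra II, 1960, Appendix 5.
-/

noncomputable section

open MvPowerSeries IsLocalRing Finsupp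
open Literature.RingTheory.MvPowerSeries.Jets

namespace Literature.AlgebraicGeometry.Resolution.PlaneChart

variable {κ : Type*} [Field κ]

/-- A finitely supported function on `Fin 2` is the sum of its two `single`s (`j ≠ i`). [folklore] -/
theorem eq_single_add_single {i j : Fin 2} (hij : j ≠ i) (e : Fin 2 →₀ ℕ) :
    e = single i (e i) + single j (e j) := by
  ext l
  have hl : l = i ∨ l = j := by fin_cases i <;> fin_cases j <;> fin_cases l <;> simp_all
  rcases hl with rfl | rfl
  · simp [hij]
  · simp [hij.symm]

/-- The degree of an exponent on `Fin 2` is the sum of its two entries (`j ≠ i`). [folklore] -/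
theorem degree_eq_add {i j : Fin 2} (hij : j ≠ i) (e : Fin 2 →₀ ℕ) : e.degree = e i + e j := by
  conv_lhs => rw [eq_single_add_single hij e]
  rw [map_add, degree_single, degree_single]

/-- The maximal ideal of `κ⟦X₀, X₁⟧` is `(X i, X j)` (`j ≠ i`). [folklore] -/
theorem maximalIdeal_eq_span_pair {i j : Fin 2} (hij : j ≠ i) :
    maximalIdeal (MvPowerSeries (Fin 2) κ) = Ideal.span {(X i : MvPowerSeries (Fin 2) κ), X j} := by
  rw [maximalIdeal_mvPowerSeries_eq_span]
  congr 1
  ext f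
  simp only [Set.mem_range, Set.mem_insert_iff, Set.mem_singleton_iff]
  constructor
  · rintro ⟨l, rfl⟩
    have hl : l = i ∨ l = j := by fin_cases i <;> fin_cases j <;> fin_cases l <;> simp_all
    rcases hl with rfl | rfl
    · exact Or.inl rfl
    · exact Or.inr rfl
  · rintro (rfl | rfl)
    exacts [⟨i, rfl⟩, ⟨j, rfl⟩]

section Chart

variable {i j : Fin 2} (hij : j ≠ i) (t : κ)
  (Θ : MvPowerSeries (Fin 2) κ →ₐ[κ] MvPowerSeries (Fin 2) κ)
  (hΘi : Θ (X i) = X i) (hΘj : Θ (X j) = X i * (X j + C t))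

include hij hΘi hΘj in
/-- `Θ(𝔪) ⊆ (X i)`. [folklore] -/
theorem map_maximalIdeal_le_span_X :
    (maximalIdeal (MvPowerSeries (Fin 2) κ)).map Θ ≤ Ideal.span {(X i : MvPowerSeries (Fin 2) κ)} := by
  rw [maximalIdeal_eq_span_pair hij, Ideal.map_span, Ideal.span_le]
  rintro _ ⟨f, hf, rfl⟩
  simp only [Set.mem_insert_iff, Set.mem_singleton_iff] at hf
  rcases hf with rfl | rfl
  · rw [SetLike.mem_coe, hΘi]
    exact Ideal.mem_span_singleton_self _
  · rw [SetLike.mem_coe, hΘj]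
    exact Ideal.mem_span_singleton'.mpr ⟨X j + C t, by ring⟩

include hij hΘi hΘj in
/-- `Θ(𝔪ᴺ) ⊆ (X i ^ N)`: `X i ^ N` divides `Θ g` for `g ∈ 𝔪ᴺ`. [folklore] -/
theorem X_pow_dvd_of_mem_maximalIdeal_pow {N : ℕ} {g : MvPowerSeries (Fin 2) κ}
    (hg : g ∈ maximalIdeal (MvPowerSeries (Fin 2) κ) ^ N) :
    (X i : MvPowerSeries (Fin 2) κ) ^ N ∣ Θ g := by
  have hle : ((maximalIdeal (MvPowerSeries (Fin 2) κ)) ^ N).map Θ ≤ Ideal.span {(X i) ^ N} := by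
    rw [Ideal.map_pow, ← Ideal.span_singleton_pow]
    exact Ideal.pow_right_mono (map_maximalIdeal_le_span_X hij t Θ hΘi hΘj) N
  exact Ideal.mem_span_singleton.mp (hle (Ideal.mem_map_of_mem _ hg))

include hij hΘi hΘj in
/-- `Θ g ≡ g(0) (mod X i)`. [folklore] -/
theorem X_dvd_sub_C_constantCoeff (g : MvPowerSeries (Fin 2) κ) :
    (X i : MvPowerSeries (Fin 2) κ) ∣ Θ g - C (constantCoeff g) := by
  have hm : g - C (constantCoeff g) ∈ maximalIdeal (MvPowerSeries (Fin 2) κ) := by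
    rw [mem_maximalIdeal_iff_constantCoeff_eq_zero, map_sub, constantCoeff_C, sub_self]
  have := map_maximalIdeal_le_span_X hij t Θ hΘi hΘj (Ideal.mem_map_of_mem _ hm)
  rw [map_sub, algHom_C] at this
  exact Ideal.mem_span_singleton.mp this

end Chart


/-! ### The leading slice formula -/

/-- Exponents of equal degree that are comparable are equal. [folklore] -/
theorem eq_of_le_of_degree_eq {σ : Type*} {e e' : σ →₀ ℕ} (hle : e ≤ e') (hdeg : e.degree = e'.degree) :
    e = e' := by
  obtain ⟨f, rfl⟩ := exists_add_of_le hle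
  rw [map_add] at hdeg
  have hf : f.degree = 0 := by omega
  rw [Finsupp.degree_eq_zero_iff] at hf
  rw [hf, add_zero]

/-- A monomial of `κ⟦X₀, X₁⟧` as a product of powers of the two variables (`j ≠ i`). [folklore] -/
theorem monomial_one_eq_X_pow_mul_X_pow {i j : Fin 2} (hij : j ≠ i) (e : Fin 2 →₀ ℕ) :
    monomial e (1 : κ) = (X i : MvPowerSeries (Fin 2) κ) ^ e i * X j ^ e j := by
  rw [X_pow_eq, X_pow_eq, monomial_mul_monomial, one_mul, ← eq_single_add_single hij e]

/-- Coefficient extraction behind a power of `X i`: the coefficient of `X i ^ d · X^m` in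
`X i ^ d * F` is the coefficient of `X^m` in `F`. [folklore] -/
theorem coeff_single_add_X_pow_mul {σ : Type*} (i : σ) (d : ℕ) (m : σ →₀ ℕ) (F : MvPowerSeries σ κ) :
    coeff (single i d + m) ((X i : MvPowerSeries σ κ) ^ d * F) = coeff m F := by
  classical
  rw [X_pow_eq, coeff_monomial_mul, if_pos le_self_add, one_mul, add_tsub_cancel_left]

/-- No coefficient of `X i ^ (d + 1) * G` has `X i`-exponent `d`: for an exponent `m` with
`m i = d`, `coeff m (X i ^ (d+1) * G) = 0`. [folklore] -/
theorem coeff_X_pow_succ_mul_eq_zero {σ : Type*} (i : σ) {d : ℕ} {m : σ →₀ ℕ} (hm : m i = d)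
    (G : MvPowerSeries σ κ) : coeff m ((X i : MvPowerSeries σ κ) ^ (d + 1) * G) = 0 := by
  classical
  rw [X_pow_eq, coeff_monomial_mul, if_neg]
  intro hle
  have := hle i
  rw [single_eq_same] at this
  omega

/-- The `X j ^ k`-coefficient of `(X j + C t) ^ b` is the binomial `C(b, k) t^{b-k}`. [folklore] -/
theorem coeff_single_X_add_C_pow (j : Fin 2) (t : κ) (b k : ℕ) :
    coeff (single j k) (((X j : MvPowerSeries (Fin 2) κ) + C t) ^ b) = (b.choose k : κ) * t ^ (b - k) := by
  classical
  rw [add_pow, map_sum]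
  have hterm : ∀ l ∈ Finset.range (b + 1),
      coeff (single j k) ((X j : MvPowerSeries (Fin 2) κ) ^ l * C t ^ (b - l) * (b.choose l : MvPowerSeries (Fin 2) κ)) =
        if l = k then (b.choose k : κ) * t ^ (b - k) else 0 := by
    intro l _
    rw [← map_pow, ← map_natCast (C : κ →+* MvPowerSeries (Fin 2) κ), mul_assoc, ← map_mul, X_pow_eq,
      ← MvPowerSeries.monomial_zero_eq_C_apply, monomial_mul_monomial, add_zero, one_mul, coeff_monomial]
    by_cases hlk : l = k
    · subst hlk; rw [if_pos rfl, if_pos rfl, mul_comm]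
    · rw [if_neg, if_neg hlk]
      intro h
      exact hlk (single_injective j h).symm
  rw [Finset.sum_congr rfl hterm, Finset.sum_ite_eq' (Finset.range (b + 1)) k]
  split_ifs with hk
  · rfl
  · rw [Finset.mem_range, not_lt] at hk
    rw [Nat.choose_eq_zero_of_lt (by omega), Nat.cast_zero, zero_mul]

section Chart2

variable {i j : Fin 2} (hij : j ≠ i) (t : κ)
  (Θ : MvPowerSeries (Fin 2) κ →ₐ[κ] MvPowerSeries (Fin 2) κ)
  (hΘi : Θ (X i) = X i) (hΘj : Θ (X j) = X i * (X j + C t))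

include hij hΘi hΘj in
/-- `Θ` on a monomial times a series: the coefficient of `X i ^ d * X j ^ k` in
`Θ (X^e · h)` (`|e| = d`) is `h(0) · C(e j, k) · t ^ (e j - k)`. [folklore] -/
theorem coeff_apply_monomial_mul {d : ℕ} {e : Fin 2 →₀ ℕ} (he : e.degree = d)
    (h : MvPowerSeries (Fin 2) κ) (k : ℕ) :
    coeff (single i d + single j k) (Θ (monomial e (1 : κ) * h)) =
      constantCoeff h * ((e j).choose k : κ) * t ^ (e j - k) := by
  obtain ⟨q, hq⟩ := X_dvd_sub_C_constantCoeff hij t Θ hΘi hΘj h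
  have hΘh : Θ h = C (constantCoeff h) + X i * q := by rw [← hq]; ring
  have hd : e i + e j = d := by rw [← degree_eq_add hij e, he]
  have hΘmon : Θ (monomial e (1 : κ) * h) =
      X i ^ d * ((X j + C t) ^ e j * C (constantCoeff h)) +
        X i ^ (d + 1) * ((X j + C t) ^ e j * q) := by
    rw [monomial_one_eq_X_pow_mul_X_pow hij e, map_mul Θ, map_mul Θ, map_pow Θ, map_pow Θ, hΘi, hΘj,
      hΘh, ← hd, mul_pow]
    ring
  rw [hΘmon, map_add, coeff_single_add_X_pow_mul,
    coeff_X_pow_succ_mul_eq_zero i (by simp [hij]) _, add_zero, coeff_mul_C,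
    coeff_single_X_add_C_pow]
  ring

/-- Coefficients of a monomial times a series along the degree of the monomial: for `|e| = d` and
`l ≤ d`, the coefficient of `X i ^ (d-l) X j ^ l` in `X^e · h` is `h(0)` if `l = e j` and `0`
otherwise (`j ≠ i`). [folklore] -/
theorem coeff_monomial_mul_along_degree (hij : j ≠ i) {d l : ℕ} (hl : l ≤ d) {e : Fin 2 →₀ ℕ}
    (he : e.degree = d) (h : MvPowerSeries (Fin 2) κ) :
    coeff (single i (d - l) + single j l) (monomial e (1 : κ) * h) =
      if l = e j then constantCoeff h else 0 := by
  classical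
  have hdeg : (single i (d - l) + single j l : Fin 2 →₀ ℕ).degree = d := by
    rw [map_add, degree_single, degree_single]; omega
  rw [coeff_monomial_mul]
  by_cases hle : e ≤ single i (d - l) + single j l
  · have heq : e = single i (d - l) + single j l := eq_of_le_of_degree_eq hle (by rw [he, hdeg])
    rw [if_pos hle, one_mul, ← heq, tsub_self, coeff_zero_eq_constantCoeff, if_pos]
    rw [heq]
    simp [hij]
  · rw [if_neg hle, if_neg]
    intro hlj
    apply hle
    have hd : e i + e j = d := by rw [← degree_eq_add hij e, he]
    rw [eq_single_add_single hij e, ← hlj]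
    have : e i = d - l := by omega
    rw [this]

include hij hΘi hΘj in
/-- **Leading slice formula.** For `g ∈ 𝔪ᵈ` the coefficient of `X i ^ d * X j ^ k` in `Θ g` is
`Σ_{l ≤ d} g_{(d-l) eᵢ + l eⱼ} · C(l, k) · t ^ (l - k)` — the `k`-th Taylor coefficient at `t` of
the dehomogenised degree-`d` form of `g` (blow up, chart `X i`, translate by `t`). [folklore] -/
theorem coeff_leading_slice {d : ℕ} {g : MvPowerSeries (Fin 2) κ}
    (hg : g ∈ maximalIdeal (MvPowerSeries (Fin 2) κ) ^ d) (k : ℕ) :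
    coeff (single i d + single j k) (Θ g) =
      ∑ l ∈ Finset.range (d + 1),
        coeff (single i (d - l) + single j l) g * ((l.choose k : κ) * t ^ (l - k)) := by
  classical
  obtain ⟨S, h, hS, rfl⟩ := exists_eq_sum_monomial_mul d g
    (fun e he => coeff_eq_zero_of_mem_maximalIdeal_pow hg he)
  rw [map_sum, map_sum]
  simp_rw [map_sum, Finset.sum_mul]
  rw [Finset.sum_comm]
  refine Finset.sum_congr rfl fun e heS => ?_
  rw [coeff_apply_monomial_mul hij t Θ hΘi hΘj (hS e heS) (h e) k]
  have hej : e j ≤ d := by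
    have := degree_eq_add hij e; rw [hS e heS] at this; omega
  rw [Finset.sum_eq_single_of_mem (e j) (Finset.mem_range.mpr (by omega))]
  · rw [coeff_monomial_mul_along_degree hij hej (hS e heS), if_pos rfl]; ring
  · intro l hl hne
    rw [coeff_monomial_mul_along_degree hij (by simpa [Nat.lt_succ_iff] using hl) (hS e heS), if_neg hne,
      zero_mul]

end Chart2


/-! ### Taylor form of the slice; injectivity -/

/-- Taylor coefficients of an explicit polynomial `Σ_{l ≤ N} a_l X^l`:
`(taylor t P).coeff k = Σ_{l ≤ N} a_l · C(l, k) · t^{l-k}`. [folklore] -/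
theorem taylor_coeff_sum_C_mul_X_pow (a : ℕ → κ) (N : ℕ) (t : κ) (k : ℕ) :
    (Polynomial.taylor t (∑ l ∈ Finset.range (N + 1), Polynomial.C (a l) * Polynomial.X ^ l)).coeff k =
      ∑ l ∈ Finset.range (N + 1), a l * ((l.choose k : κ) * t ^ (l - k)) := by
  rw [map_sum, Polynomial.finsetSum_coeff]
  refine Finset.sum_congr rfl fun l _ => ?_
  rw [Polynomial.C_mul_X_pow_eq_monomial, Polynomial.taylor_monomial, Polynomial.coeff_C_mul,
    Polynomial.coeff_X_add_C_pow, mul_comm (t ^ (l - k))]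

section Chart3

variable {i j : Fin 2} (hij : j ≠ i) (t : κ)
  (Θ : MvPowerSeries (Fin 2) κ →ₐ[κ] MvPowerSeries (Fin 2) κ)
  (hΘi : Θ (X i) = X i) (hΘj : Θ (X j) = X i * (X j + C t))

include hij hΘi hΘj in
/-- **Leading slice = Taylor expansion.** For `g ∈ 𝔪ᵈ`, the `X i ^ d`-slice of `Θ g` is the Taylor
expansion at `t` of the dehomogenised degree-`d` form `P(y) = Σ_{l ≤ d} g_{(d-l)eᵢ + l eⱼ} yˡ`.
[folklore] -/
theorem coeff_leading_slice_eq_taylor {d : ℕ} {g : MvPowerSeries (Fin 2) κ}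
    (hg : g ∈ maximalIdeal (MvPowerSeries (Fin 2) κ) ^ d) (k : ℕ) :
    coeff (single i d + single j k) (Θ g) =
      (Polynomial.taylor t (∑ l ∈ Finset.range (d + 1),
        Polynomial.C (coeff (single i (d - l) + single j l) g) * Polynomial.X ^ l)).coeff k := by
  rw [coeff_leading_slice hij t Θ hΘi hΘj hg k, taylor_coeff_sum_C_mul_X_pow]

include hij hΘi hΘj in
/-- **Injectivity of the chart endomorphism.** [folklore] -/
theorem injective_of_chart : Function.Injective Θ := by
  rw [injective_iff_map_eq_zero]
  intro g hg
  by_contra hg0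
  -- the order `d` of `g` and a non-zero coefficient of degree `d`
  have hfin : g.order.toNat = g.order := (ne_zero_iff_order_finite).mp hg0
  set d := g.order.toNat with hd
  have hgm : g ∈ maximalIdeal (MvPowerSeries (Fin 2) κ) ^ d :=
    mem_maximalIdeal_pow_of_le_order (by rw [hfin])
  obtain ⟨e, he, hdeg⟩ := exists_coeff_ne_zero_and_order hfin
  have hdeg' : e.degree = d := by
    have : (e.degree : ℕ∞) = (d : ℕ∞) := by rw [hdeg, ← hfin]
    exact_mod_cast this
  -- the dehomogenised leading form `P` is a non-zero polynomial
  set P : Polynomial κ := ∑ l ∈ Finset.range (d + 1),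
    Polynomial.C (coeff (single i (d - l) + single j l) g) * Polynomial.X ^ l with hP
  have hPcoeff : ∀ l, P.coeff l = if l < d + 1 then coeff (single i (d - l) + single j l) g else 0 := by
    intro l
    rw [hP, Polynomial.finsetSum_coeff]
    simp_rw [Polynomial.coeff_C_mul_X_pow]
    rw [Finset.sum_ite_eq (Finset.range (d + 1)) l]
    simp only [Finset.mem_range]
  have hP0 : P ≠ 0 := by
    intro h0
    have hej : e j < d + 1 := by
      have := degree_eq_add hij e; rw [hdeg'] at this; omega
    have := hPcoeff (e j)
    rw [h0, Polynomial.coeff_zero, if_pos hej] at this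
    apply he
    have hee : single i (d - e j) + single j (e j) = e := by
      have hsum := degree_eq_add hij e
      rw [hdeg'] at hsum
      conv_rhs => rw [eq_single_add_single hij e]
      congr 2; omega
    rw [← hee]; exact this.symm
  -- but every Taylor coefficient of `P` at `t` is a coefficient of `Θ g = 0`
  have htay : Polynomial.taylor t P = 0 := by
    ext k
    rw [Polynomial.coeff_zero, ← coeff_leading_slice_eq_taylor hij t Θ hΘi hΘj hgm k, hg, map_zero]
  exact hP0 ((Polynomial.taylor_injective t) (by rw [htay, map_zero]))

end Chart3

end Literature.AlgebraicGeometry.Resolution.PlaneChart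

end
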